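import Literature.AlgebraicGeometry.Morphisms.ClosedImmersionOfFibres
import Literature.AlgebraicGeometry.Morphisms.ProjectiveSpaceOverBasePoints
import Literature.AlgebraicGeometry.Morphisms.ProjectiveSpaceOverAffine
import Literature.AlgebraicGeometry.Morphisms.ProjectiveMorphism
import Literature.AlgebraicGeometry.Motives.GeneratingSectionsComap
import Literature.AlgebraicGeometry.Motives.MorphismsToProjectiveSpaceBaseChange
import HarnessLib

/-!
# Projective over a general base: a global generating-sections datum embeds `X ↪ 𝐏(ι; T)` iff it does so on every fibre

Topic `AlgebraicGeometry/Morphisms`; namespace `Literature.AlgebraicGeometry.Morphisms`. THEOREMS ONLY (no definition, no named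
fact, no instance, no `sorry`).

`f : X → T` a PROPER morphism to an ARBITRARY scheme `T`, `ι` a finite type and `D` a generating-sections datum on `X` indexed by
the `#ι + 1` homogeneous coordinates of `𝐏ⁿ_ℤ` (★ `Motives.GeneratingSections`: global sections of a line bundle generating it, in
chart form — e.g. a frame of `π_*M`). The datum defines the `T`-morphism `X → 𝐏(ι; T) = T ×_ℤ 𝐏ⁿ_ℤ`
(★ `projectiveSpace.pointOfSections`, Hartshorne II Thm. 7.1 over `ℤ` paired with `f`). We prove:

* `isClosedImmersion_pointOfSections_of_isPullback` — if for every `t ∈ T` the fibre of `f` at `t`, presented by ANY cartesian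
  square over some `Spec K → T` through which `Spec κ(t) → T` factors, is embedded into `ℙⁿ_K` by the restricted datum
  (★ `GeneratingSections.comap`, ★ `toProj`), then `X → 𝐏(ι; T)` is a CLOSED IMMERSION; hence
  `isProjective_of_generatingSections_of_isPullback : IsProjective f` (★ `IsProjective`, Hartshorne's definition);
* `isClosedImmersion_pointOfSections_of_fibres` / `isProjective_of_generatingSections_of_fibres` — the same with Mathlib's
  scheme-theoretic fibres `f.fiber t → Spec κ(t)`;
* `isProjective_of_generatingSections_of_primes` — base `T = Spec A`, fibres over `Spec κ(𝔭) = Spec (A → κ(𝔭))` (the dialect of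
  ★ `Morphisms/ProjectiveOfFibresEmbedding`, whose §2 is the special case of a spanning family).

Road: the fibrewise criterion for closed immersions ★ `isClosedImmersion_of_forall_isPullback` (EGA III 4.6.7 (ii), with
`P₀ := 𝐏(ι; Spec K)`, ★ `isPullback_projectiveSpaceMap`: projective space commutes with base change), the comparison
`ℙⁿ_K ≅ 𝐏(ι; Spec K)` (★ `isPullback_projToSpec_projMap_terminal`, `projectiveSpaceSpec_isoPullback_hom_fst/_snd`) and the
base-change / restriction calculus of `toProj` (★ `toProj_comp_SpecMap_algebraMap`, ★ `comap_toProj`,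
★ `homEquiv_pointOfSections`). No noetherian or flatness hypothesis: the sections are already global. Cell `hodgecm-mathlib`,
F-DAG (h2)/F-6 capital (B-p20 (g11)): the step «`(A/T, λ, level, frame of π_*L^Δ(λ)³)` ↦ closed immersion `A ↪ 𝐏^m_T`, checked
on the fibres» over a NON-affine `T`. Count-neutral (HC_CM is proved only modulo the 7 printed citations until rung 0 closes).

## References
* A. Grothendieck, J. Dieudonné, *EGA III₁* (Publ. Math. IHÉS 11, 1961), Prop. 4.6.7 (ii), Thm. 4.7.1. [EGAIII1]
* R. Hartshorne, *Algebraic Geometry* (1977), II Thm. 7.1; II §4 Definition p.103 (projective morphism). [Hartshorne1977]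
* The Stacks project, Tag 01NF (`𝐏ⁿ_S` and base change). [StacksProject]
-/

noncomputable section

-- Mathlib's pull-back API is stated through `abbrev`s over `limit`; as in ★ `ProjectiveSpaceOverBasePoints`.
set_option backward.isDefEq.respectTransparency false

universe u

open CategoryTheory CategoryTheory.Limits AlgebraicGeometry TopologicalSpace
open Literature.AlgebraicGeometry.Motives Literature.AlgebraicGeometry.Motives.GeneratingSections
open Literature.AlgebraicGeometry.Motives (ProjBaseChangeRing.mapGraded ProjBaseChangeRing.irrelevant_le_map
  ProjBaseChangeRing.projToSpec)

namespace Literature.AlgebraicGeometry.Morphisms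

attribute [local instance] MvPolynomial.gradedAlgebra

section General

variable {X T : Scheme.{u}} (f : X ⟶ T) (ι : Type u) (D : GeneratingSections (Fin (Nat.card ι + 1)) X)

/-! ## §1 One fibre presented over `Spec K`: the restricted datum, compared in `𝐏(ι; T)` -/

/-- **The fibre morphism and the global morphism agree in `𝐏(ι; T)`.** For a cartesian square presenting `X₀ = X ×_T Spec K`,
the morphism `X₀ → ℙⁿ_K ≅ 𝐏(ι; Spec K) → 𝐏(ι; T)` of the restricted datum is `X₀ → X → 𝐏(ι; T)` (both components agree:
over `T` by the square, over `𝐏ⁿ_ℤ` by ★ `toProj_comp_SpecMap_algebraMap` + ★ `comap_toProj`).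
[cite: Hartshorne1977, II Thm. 7.1] [cite: StacksProject, Tag 01NF] -/
theorem toProj_comap_isoPullback_projectiveSpaceMap {K : Type u} [CommRing K] (iK : Spec (.of K) ⟶ T)
    {X₀ : Scheme.{u}} {iX : X₀ ⟶ X} {f₀ : X₀ ⟶ Spec (.of K)} (HX : IsPullback iX f₀ f iK) :
    letI : Algebra intU.{u} K := ULift.algebra' ℤ K
    ((D.comap iX).toProj f₀ ≫ (isPullback_projToSpec_projMap_terminal ι K).isoPullback.hom) ≫ projectiveSpaceMap ι iK =
      iX ≫ (projectiveSpace.pointOfSections (Over.mk f) D).left := by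
  letI : Algebra intU.{u} K := ULift.algebra' ℤ K
  refine pullback.hom_ext ?_ ?_
  · rw [Category.assoc, Category.assoc, projectiveSpaceMap_fst, projectiveSpaceSpec_isoPullback_hom_fst_assoc,
      Category.assoc]
    have h₂ : (D.comap iX).toProj f₀ ≫ ProjBaseChangeRing.projToSpec (Fin (Nat.card ι + 1)) K = f₀ :=
      (D.comap iX).toProj_toSpec f₀
    rw [reassoc_of% h₂, ← HX.w]
    congr 1
    exact (Over.w (projectiveSpace.pointOfSections (Over.mk f) D)).symm
  · rw [Category.assoc, Category.assoc, projectiveSpaceMap_snd, projectiveSpaceSpec_isoPullback_hom_snd,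
      ← GeneratingSections.toProj_comp_SpecMap_algebraMap, Category.assoc]
    change _ = iX ≫ projectiveSpace.homEquiv (Over.mk f) (projectiveSpace.pointOfSections (Over.mk f) D)
    rw [projectiveSpace.homEquiv_pointOfSections, ← GeneratingSections.comap_toProj]
    congr 1
    exact specULiftZIsTerminal.hom_ext _ _

/-- The fibre morphism `X₀ → ℙⁿ_K ≅ 𝐏(ι; Spec K)` lies over `Spec K`. [cite: Hartshorne1977, II Thm. 7.1] -/
theorem toProj_comap_isoPullback_fst {K : Type u} [CommRing K] {X₀ : Scheme.{u}} (iX : X₀ ⟶ X)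
    (f₀ : X₀ ⟶ Spec (.of K)) :
    letI : Algebra intU.{u} K := ULift.algebra' ℤ K
    ((D.comap iX).toProj f₀ ≫ (isPullback_projToSpec_projMap_terminal ι K).isoPullback.hom) ≫
      projectiveSpaceFst ι (Spec (.of K)) = f₀ := by
  letI : Algebra intU.{u} K := ULift.algebra' ℤ K
  rw [Category.assoc, projectiveSpaceSpec_isoPullback_hom_fst]
  exact (D.comap iX).toProj_toSpec f₀

/-! ## §2 The fibrewise criterion -/

/-- **`X → 𝐏(ι; T)` is a closed immersion as soon as every fibre `X ×_T Spec K → ℙⁿ_K` is** (`f` proper; flexible fibre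
presentations: for each `t`, ANY cartesian square over some `Spec K → T` through which `Spec κ(t) → T` factors). EGA III 4.6.7
(ii) at every point (★ `isClosedImmersion_of_forall_isPullback`) with `𝐏(ι; Spec K) = Spec K ×_T 𝐏(ι; T)`
(★ `isPullback_projectiveSpaceMap`). [cite: EGAIII1, Prop. 4.6.7 (ii)] [cite: Hartshorne1977, II Thm. 7.1] -/
theorem isClosedImmersion_pointOfSections_of_isPullback [IsProper f]
    (H : ∀ t : T, ∃ (K : Type u) (_ : CommRing K) (iK : Spec (.of K) ⟶ T) (σ : Spec (T.residueField t) ⟶ Spec (.of K))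
      (_ : σ ≫ iK = T.fromSpecResidueField t) (X₀ : Scheme.{u}) (iX : X₀ ⟶ X) (f₀ : X₀ ⟶ Spec (.of K))
      (_ : IsPullback iX f₀ f iK), IsClosedImmersion ((D.comap iX).toProj f₀)) :
    IsClosedImmersion (projectiveSpace.pointOfSections (Over.mk f) D).left := by
  refine isClosedImmersion_of_forall_isPullback f (projectiveSpaceFst ι T) (projectiveSpace.pointOfSections (Over.mk f) D).left
    (Over.w (projectiveSpace.pointOfSections (Over.mk f) D)) fun t ↦ ?_
  obtain ⟨K, _, iK, σ, hσ, X₀, iX, f₀, HX, hK⟩ := H t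
  letI : Algebra intU.{u} K := ULift.algebra' ℤ K
  haveI := hK
  exact ⟨Spec (.of K), X₀, projectiveSpace ι (Spec (.of K)), iK, σ, hσ, iX, f₀, HX, projectiveSpaceMap ι iK,
    projectiveSpaceFst ι _, isPullback_projectiveSpaceMap ι iK,
    (D.comap iX).toProj f₀ ≫ (isPullback_projToSpec_projMap_terminal ι K).isoPullback.hom,
    toProj_comap_isoPullback_projectiveSpaceMap f ι D iK HX, toProj_comap_isoPullback_fst ι D iX f₀, inferInstance⟩

/-- **Hence `f` is PROJECTIVE** (Hartshorne's definition, ★ `IsProjective`: the closed immersion `X ↪ 𝐏(ι; T)` over `T`).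
[cite: Hartshorne1977, II §4 Definition p.103 (projective morphism)] [cite: EGAIII1, Thm. 4.7.1] -/
theorem isProjective_of_generatingSections_of_isPullback [Finite ι] [IsProper f]
    (H : ∀ t : T, ∃ (K : Type u) (_ : CommRing K) (iK : Spec (.of K) ⟶ T) (σ : Spec (T.residueField t) ⟶ Spec (.of K))
      (_ : σ ≫ iK = T.fromSpecResidueField t) (X₀ : Scheme.{u}) (iX : X₀ ⟶ X) (f₀ : X₀ ⟶ Spec (.of K))
      (_ : IsPullback iX f₀ f iK), IsClosedImmersion ((D.comap iX).toProj f₀)) :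
    IsProjective f :=
  ⟨ι, inferInstance, (projectiveSpace.pointOfSections (Over.mk f) D).left,
    isClosedImmersion_pointOfSections_of_isPullback f ι D H, Over.w (projectiveSpace.pointOfSections (Over.mk f) D)⟩

/-- **Scheme-theoretic fibres form**: if the restricted datum embeds every fibre `f⁻¹(t) → ℙⁿ_{κ(t)}` (Mathlib
`Scheme.Hom.fiber`), then `X → 𝐏(ι; T)` is a closed immersion. [cite: EGAIII1, Prop. 4.6.7 (ii)] [cite: Hartshorne1977, II Thm. 7.1] -/
theorem isClosedImmersion_pointOfSections_of_fibres [IsProper f]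
    (H : ∀ t : T, IsClosedImmersion ((D.comap (f.fiberι t)).toProj (f.fiberToSpecResidueField t))) :
    IsClosedImmersion (projectiveSpace.pointOfSections (Over.mk f) D).left :=
  isClosedImmersion_pointOfSections_of_isPullback f ι D fun t ↦
    ⟨T.residueField t, inferInstance, T.fromSpecResidueField t, 𝟙 _, Category.id_comp _, f.fiber t, f.fiberι t,
      f.fiberToSpecResidueField t, IsPullback.of_hasPullback f (T.fromSpecResidueField t), H t⟩

/-- **A proper morphism whose global generating sections embed every fibre is projective** (any base scheme).
[cite: Hartshorne1977, II §4 Definition p.103 (projective morphism)] [cite: EGAIII1, Thm. 4.7.1] -/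
theorem isProjective_of_generatingSections_of_fibres [Finite ι] [IsProper f]
    (H : ∀ t : T, IsClosedImmersion ((D.comap (f.fiberι t)).toProj (f.fiberToSpecResidueField t))) :
    IsProjective f :=
  ⟨ι, inferInstance, (projectiveSpace.pointOfSections (Over.mk f) D).left,
    isClosedImmersion_pointOfSections_of_fibres f ι D H, Over.w (projectiveSpace.pointOfSections (Over.mk f) D)⟩

end General

/-! ## §3 Affine base `Spec A`, fibres over `Spec (A → κ(𝔭))` -/

section Affine

variable {A : Type u} [CommRing A] {X : Scheme.{u}} (f : X ⟶ Spec (.of A)) [IsProper f] (ι : Type u) [Finite ι]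
  (D : GeneratingSections (Fin (Nat.card ι + 1)) X)

/-- **Over `Spec A`**: if at every prime `𝔭` the fibre `X ×_A κ(𝔭)` (ANY cartesian square over `Spec (A → κ(𝔭))`) is embedded
into `ℙⁿ_{κ(𝔭)}` by the restricted datum, then `f` is projective — the dialect of ★ `Morphisms/ProjectiveOfFibresEmbedding` and
★ `Morphisms/ProjectiveOfFibreEmbedding` (whose heads supply the hypothesis from «the complete linear system embeds + `H¹ = 0`»).
[cite: EGAIII1, Thm. 4.7.1] [cite: Hartshorne1977, II §4 Definition p.103 (projective morphism)] -/
theorem isProjective_of_generatingSections_of_primes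
    (H : ∀ 𝔭 : PrimeSpectrum A, ∃ (X₀ : Scheme.{u}) (iX : X₀ ⟶ X) (f₀ : X₀ ⟶ Spec (.of 𝔭.asIdeal.ResidueField))
      (_ : IsPullback iX f₀ f (Spec.map (CommRingCat.ofHom (algebraMap A 𝔭.asIdeal.ResidueField)))),
      IsClosedImmersion ((D.comap iX).toProj f₀)) :
    IsProjective f := by
  refine isProjective_of_generatingSections_of_isPullback f ι D fun 𝔭 ↦ ?_
  obtain ⟨X₀, iX, f₀, HX, hK⟩ := H 𝔭
  exact ⟨𝔭.asIdeal.ResidueField, inferInstance, Spec.map (CommRingCat.ofHom (algebraMap A 𝔭.asIdeal.ResidueField)),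
    Spec.map (Scheme.Spec.residueFieldIso (.of A) 𝔭).inv,
    Scheme.Spec.map_residueFieldIso_inv_eq_fromSpecResidueField (.of A) 𝔭, X₀, iX, f₀, HX, hK⟩

end Affine

/-! ## §4 `Fin (n + 1)`-indexed data (edition 2) -/

section FinIndexed

variable {X T : Scheme.{u}} (f : X ⟶ T) [IsProper f] {n : ℕ} (D : GeneratingSections (Fin (n + 1)) X)

/-- **`Fin (n+1)`-indexed front-end** of `isProjective_of_generatingSections_of_isPullback`: for a datum indexed by `Fin (n + 1)`
(e.g. ★ `ofCocycleSections F.U (CocycleSections.ofFrameSystem F h1 b)` for `b : Fin (n+1) → Γ(X, E)`), if every fibre (any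
presentation over some `Spec K → T`) is embedded by the restricted datum then `f` is projective (take `ι := ULift (Fin n)`,
`Nat.card ι = n`). [cite: Hartshorne1977, II §4 Definition p.103 (projective morphism)] [cite: EGAIII1, Thm. 4.7.1] -/
theorem isProjective_of_generatingSections_fin_of_isPullback
    (H : ∀ t : T, ∃ (K : Type u) (_ : CommRing K) (iK : Spec (.of K) ⟶ T) (σ : Spec (T.residueField t) ⟶ Spec (.of K))
      (_ : σ ≫ iK = T.fromSpecResidueField t) (X₀ : Scheme.{u}) (iX : X₀ ⟶ X) (f₀ : X₀ ⟶ Spec (.of K))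
      (_ : IsPullback iX f₀ f iK), IsClosedImmersion ((D.comap iX).toProj f₀)) :
    IsProjective f := by
  obtain ⟨ι, hι, hn⟩ : ∃ ι : Type u, Finite ι ∧ Nat.card ι = n :=
    ⟨ULift.{u} (Fin n), inferInstance, by rw [Nat.card_ulift, Nat.card_fin]⟩
  subst hn
  haveI := hι
  exact isProjective_of_generatingSections_of_isPullback f ι D H

/-- **`Fin (n+1)`-indexed front-end, scheme-theoretic fibres**: if the restricted datum embeds every fibre
`f⁻¹(t) → ℙⁿ_{κ(t)}`, then `f` is projective. [cite: Hartshorne1977, II §4 Definition p.103 (projective morphism)]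
[cite: EGAIII1, Thm. 4.7.1] -/
theorem isProjective_of_generatingSections_fin_of_fibres
    (H : ∀ t : T, IsClosedImmersion ((D.comap (f.fiberι t)).toProj (f.fiberToSpecResidueField t))) :
    IsProjective f := by
  obtain ⟨ι, hι, hn⟩ : ∃ ι : Type u, Finite ι ∧ Nat.card ι = n :=
    ⟨ULift.{u} (Fin n), inferInstance, by rw [Nat.card_ulift, Nat.card_fin]⟩
  subst hn
  haveI := hι
  exact isProjective_of_generatingSections_of_fibres f ι D H

/-- **`Fin (n+1)`-indexed front-end over `Spec A`** (fibres over `Spec (A → κ(𝔭))`, any presentation).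
[cite: Hartshorne1977, II §4 Definition p.103 (projective morphism)] [cite: EGAIII1, Thm. 4.7.1] -/
theorem isProjective_of_generatingSections_fin_of_primes {A : Type u} [CommRing A] {X : Scheme.{u}}
    (f : X ⟶ Spec (.of A)) [IsProper f] {n : ℕ} (D : GeneratingSections (Fin (n + 1)) X)
    (H : ∀ 𝔭 : PrimeSpectrum A, ∃ (X₀ : Scheme.{u}) (iX : X₀ ⟶ X) (f₀ : X₀ ⟶ Spec (.of 𝔭.asIdeal.ResidueField))
      (_ : IsPullback iX f₀ f (Spec.map (CommRingCat.ofHom (algebraMap A 𝔭.asIdeal.ResidueField)))),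
      IsClosedImmersion ((D.comap iX).toProj f₀)) :
    IsProjective f := by
  obtain ⟨ι, hι, hn⟩ : ∃ ι : Type u, Finite ι ∧ Nat.card ι = n :=
    ⟨ULift.{u} (Fin n), inferInstance, by rw [Nat.card_ulift, Nat.card_fin]⟩
  subst hn
  haveI := hι
  exact isProjective_of_generatingSections_of_primes f ι D H

end FinIndexed

end Literature.AlgebraicGeometry.Morphisms
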